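import Summits.RiemannHypothesis.RiemannHypothesis.Theorems.SignConeConeMagnificationCombTypeFamilyApprox
import Summits.RiemannHypothesis.RiemannHypothesis.Theorems.SignConeConeMagnificationCombTypePeriodIntegral
import Literature.NumberTheory.LFunctions.WeilCombDifferenceSums

/-!
# Crux `SignCone.ConeMagnification` (stmt-RiemannHypothesis-16303), line `Sketch` r9, stub `stub_combType` — sharp node evaluation IV:
# the full-teeth block of a node weight, evaluated through its families

Backstop, part 4.  At the node `n` of the pair `(ℓ, ℓ')` (`g = gcd(nℓ',ℓ)`, `P = ℓ/g`, `Q = nℓ'/g`, window `h`, `K₀ = g/(nℓ'h)`), the block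
`k' ≤ K₁` of full teeth (`nℓ'K₁e^{2h} ≤ ℓM`) of the node weight is, with `V = K₁/K₀ ≥ 1/2` and `8h·nℓ'K₁ ≤ gM₀`, `2V < M₀ + 1`:

  `Σ_{k' ≤ K₁} Σ_{k ≤ M} B((log(nℓ'k'/ℓ) − log k)/h)/√(k k' n)`
  `= B(0)(√ℓ/√ℓ')/(nP)·H(⌊K₁/P⌋) + (√ℓ/√ℓ')/(nP)·[I_H − ∫_V^∞ H + (∫B)(V − 1/2) − B(0) log(2V)] + E`,
  `|E| ≤ (192N₁ + 12N₀)·h·(√ℓ/√ℓ')·(16hℓ'K₁/g + H(K₁)/n) + (16N₁ + 14N₀)·(√ℓ/√ℓ')·(ℓ'h/g)·2(1 + log(M₀ + 1))`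

(`CombType.family_block_eval`): `CombType.family_reorg` (I) + `CombType.abs_sum_familyT_sub_familyW_le` (II) + the worker's
`abs_familySum_sub_integral_le` per family `m ≠ 0` and the exact harmonic sum of the family `m = 0` + `CombType.sum_family_integrals_eq` (III).
-/

noncomputable section

-- `Summit.RiemannHypothesis.RiemannHypothesis.…` repeats a namespace component by design (D-0017 layout).
set_option linter.dupNamespace false

open scoped BigOperators
open MeasureTheory Set intervalIntegral

namespace Summit.RiemannHypothesis.RiemannHypothesis.Theorems.SignConeConeMagnification

open Literature.NumberTheory.LFunctions

namespace CombType

/-- Swapping a family double sum: `Σ_{m ∈ I} Σ_{k ∈ J, p m k} F = Σ_{k ∈ J} Σ_{m ∈ I, p m k} F`. [folklore] -/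
theorem sum_filter_comm {α β : Type*} (I : Finset α) (J : Finset β) (p : α → β → Prop) [DecidableRel p] (F : α → β → ℝ) :
    ∑ m ∈ I, ∑ k ∈ J.filter (p m), F m k = ∑ k ∈ J, ∑ m ∈ I.filter (fun m => p m k), F m k := by
  simp only [Finset.sum_filter]
  exact Finset.sum_comm

/-- `Σ_{0 < |m| ≤ N} 1/|m| ≤ 2(1 + log(N+1))`. [folklore] -/
theorem sum_inv_abs_le (N : ℕ) :
    ∑ m ∈ (Finset.Icc (-(N : ℤ)) N).erase 0, 1 / |(m : ℝ)| ≤ 2 * (1 + Real.log (N + 1)) := by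
  classical
  have hset : (Finset.Icc (-(N : ℤ)) N).erase 0
      ⊆ (Finset.Icc 1 N).image (fun j : ℕ => (j : ℤ)) ∪ (Finset.Icc 1 N).image (fun j : ℕ => -(j : ℤ)) := by
    intro m hm
    simp only [Finset.mem_erase, Finset.mem_Icc] at hm
    obtain ⟨hm0, hm1, hm2⟩ := hm
    simp only [Finset.mem_union, Finset.mem_image, Finset.mem_Icc]
    rcases lt_or_gt_of_ne hm0 with hneg | hpos
    · right; exact ⟨(-m).toNat, ⟨by omega, by omega⟩, by omega⟩
    · left; exact ⟨m.toNat, ⟨by omega, by omega⟩, by omega⟩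
  have hnn : ∀ m ∈ (Finset.Icc 1 N).image (fun j : ℕ => (j : ℤ)) ∪ (Finset.Icc 1 N).image (fun j : ℕ => -(j : ℤ)),
      (0 : ℝ) ≤ 1 / |(m : ℝ)| := fun m _ => by positivity
  refine (Finset.sum_le_sum_of_subset_of_nonneg hset fun m hm _ => hnn m hm).trans ?_
  have hunion : ∑ m ∈ (Finset.Icc 1 N).image (fun j : ℕ => (j : ℤ)) ∪ (Finset.Icc 1 N).image (fun j : ℕ => -(j : ℤ)), 1 / |(m : ℝ)|
      ≤ (∑ m ∈ (Finset.Icc 1 N).image (fun j : ℕ => (j : ℤ)), 1 / |(m : ℝ)|)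
        + ∑ m ∈ (Finset.Icc 1 N).image (fun j : ℕ => -(j : ℤ)), 1 / |(m : ℝ)| := by
    rw [← Finset.sum_union_inter]
    have : 0 ≤ ∑ m ∈ (Finset.Icc 1 N).image (fun j : ℕ => (j : ℤ)) ∩ (Finset.Icc 1 N).image (fun j : ℕ => -(j : ℤ)),
        1 / |(m : ℝ)| := Finset.sum_nonneg fun m _ => by positivity
    linarith
  refine hunion.trans ?_
  have hH : ∑ j ∈ Finset.Icc 1 N, (1 : ℝ) / j ≤ 1 + Real.log (N + 1) := by
    refine (LevinsonSums.sum_Icc_one_div_le N).trans ?_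
    rcases Nat.eq_zero_or_pos N with hN | hN
    · subst hN; simp
    · have : Real.log N ≤ Real.log (N + 1) := Real.log_le_log (by exact_mod_cast hN) (by linarith)
      linarith
  have h1 : ∑ m ∈ (Finset.Icc 1 N).image (fun j : ℕ => (j : ℤ)), 1 / |(m : ℝ)| = ∑ j ∈ Finset.Icc 1 N, (1 : ℝ) / j := by
    rw [Finset.sum_image fun a _ b _ h => by exact_mod_cast h]
    refine Finset.sum_congr rfl fun j _ => ?_
    push_cast; rw [abs_of_nonneg (Nat.cast_nonneg j)]
  have h2 : ∑ m ∈ (Finset.Icc 1 N).image (fun j : ℕ => -(j : ℤ)), 1 / |(m : ℝ)| = ∑ j ∈ Finset.Icc 1 N, (1 : ℝ) / j := by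
    rw [Finset.sum_image fun a _ b _ h => by exact_mod_cast neg_inj.1 h]
    refine Finset.sum_congr rfl fun j _ => ?_
    push_cast; rw [abs_neg, abs_of_nonneg (Nat.cast_nonneg j)]
  rw [h1, h2]; linarith

/-- The progression of the family `m = 0` is `P ∣ k'` (`Q` coprime to `P`). [folklore] -/
theorem filter_family_zero {P Q : ℕ} (hQP : Nat.Coprime Q P) (S : Finset ℕ) :
    S.filter (fun k' : ℕ => (P : ℤ) ∣ (0 : ℤ) + (Q : ℤ) * k') = S.filter (fun k' : ℕ => P ∣ k') := by
  refine Finset.filter_congr fun k' _ => ?_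
  rw [zero_add, show (Q : ℤ) * (k' : ℤ) = ((Q * k' : ℕ) : ℤ) by push_cast; ring, Int.natCast_dvd_natCast]
  exact hQP.symm.dvd_mul_left

/-- **The full-teeth block of a node weight through its families.**  See the module docstring. [folklore] -/
theorem family_block_eval {B B' B'' : ℝ → ℝ} {N₀ N₁ N₂ h : ℝ} {n ℓ ℓ' K₁ M M₀ : ℕ}
    (hB : ∀ x, HasDerivAt B (B' x) x) (hB' : ∀ x, HasDerivAt B' (B'' x) x)
    (h0 : ∀ x, |B x| ≤ N₀) (h1 : ∀ x, |B' x| ≤ N₁) (h2 : ∀ x, |B'' x| ≤ N₂)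
    (hBs : ∀ x, 2 < |x| → B x = 0)
    (hh : 0 < h) (hh16 : h ≤ 1 / 16) (hn : 1 ≤ n) (hℓ : 1 ≤ ℓ) (hℓ' : 1 ≤ ℓ')
    (hK₁ : (n : ℝ) * ℓ' * K₁ * Real.exp (2 * h) ≤ ℓ * M)
    (hM₀ : 8 * h * n * ℓ' * K₁ ≤ Nat.gcd (n * ℓ') ℓ * M₀)
    (hV : 1 / 2 ≤ (K₁ : ℝ) * n * ℓ' * h / Nat.gcd (n * ℓ') ℓ)
    (hVM : 2 * ((K₁ : ℝ) * n * ℓ' * h / Nat.gcd (n * ℓ') ℓ) < M₀ + 1) :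
    |∑ k' ∈ Finset.Icc 1 K₁, (∑ k ∈ Finset.Icc 1 M,
        B ((Real.log ((n : ℝ) * ℓ' * k' / ℓ) - Real.log k) / h) / Real.sqrt k) / Real.sqrt k' / Real.sqrt n
      - B 0 * (Real.sqrt ℓ / Real.sqrt ℓ') / n * (1 / ((ℓ / Nat.gcd (n * ℓ') ℓ : ℕ) : ℝ)) *
          ∑ j ∈ Finset.Icc 1 (K₁ / (ℓ / Nat.gcd (n * ℓ') ℓ)), (1 : ℝ) / j
      - (Real.sqrt ℓ / Real.sqrt ℓ') / n * (1 / ((ℓ / Nat.gcd (n * ℓ') ℓ : ℕ) : ℝ)) *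
          ((∫ v in Ioi (1 / 2 : ℝ), ((∑' m : ℤ, B (m / v)) - v * ∫ x, B x) / v)
            - (∫ v in Ioi ((K₁ : ℝ) * n * ℓ' * h / Nat.gcd (n * ℓ') ℓ), ((∑' m : ℤ, B (m / v)) - v * ∫ x, B x) / v)
            + (∫ x, B x) * ((K₁ : ℝ) * n * ℓ' * h / Nat.gcd (n * ℓ') ℓ - 1 / 2)
            - B 0 * Real.log (2 * ((K₁ : ℝ) * n * ℓ' * h / Nat.gcd (n * ℓ') ℓ)))|
      ≤ (192 * N₁ + 12 * N₀) * h * (Real.sqrt ℓ / Real.sqrt ℓ') *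
            (16 * h * ℓ' * K₁ / Nat.gcd (n * ℓ') ℓ + (∑ j ∈ Finset.Icc 1 K₁, (1 : ℝ) / j) / n)
        + (16 * N₁ + 14 * N₀) * (Real.sqrt ℓ / Real.sqrt ℓ') * (ℓ' * h / Nat.gcd (n * ℓ') ℓ) *
            (2 * (1 + Real.log (M₀ + 1))) := by
  classical
  -- names and basic facts
  set g : ℕ := Nat.gcd (n * ℓ') ℓ with hg
  have hg0 : 0 < g := Nat.gcd_pos_of_pos_right _ (by omega)
  have hgℓ : g ∣ ℓ := Nat.gcd_dvd_right _ _
  have hga : g ∣ n * ℓ' := Nat.gcd_dvd_left _ _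
  set P : ℕ := ℓ / g with hP
  set Q : ℕ := n * ℓ' / g with hQ
  have hP1 : 1 ≤ P := Nat.div_pos (Nat.le_of_dvd (by omega) hgℓ) hg0
  have hQP : Nat.Coprime Q P := by
    rw [hQ, hP, hg]; exact Nat.coprime_div_gcd_div_gcd hg0
  have hℓ0 : (0 : ℝ) < ℓ := by exact_mod_cast hℓ
  have hn0 : (0 : ℝ) < n := by exact_mod_cast hn
  have hℓ'0 : (0 : ℝ) < ℓ' := by exact_mod_cast hℓ'
  have hgR : (0 : ℝ) < g := by exact_mod_cast hg0
  have hPR : (0 : ℝ) < P := by exact_mod_cast hP1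
  have hN₀ : 0 ≤ N₀ := (abs_nonneg _).trans (h0 0)
  have hN₁ : 0 ≤ N₁ := (abs_nonneg _).trans (h1 0)
  have hh8 : h ≤ 1 / 8 := by linarith
  set K₀ : ℝ := (g : ℝ) / ((n : ℝ) * ℓ' * h) with hK₀
  have hK₀0 : 0 < K₀ := by positivity
  set V : ℝ := (K₁ : ℝ) * n * ℓ' * h / g with hVdef
  have hVK : (K₁ : ℝ) / K₀ = V := by rw [hK₀, hVdef]; field_simp
  set ρ : ℝ := Real.sqrt ℓ / Real.sqrt ℓ' with hρ
  have hρ0 : 0 ≤ ρ := by positivity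
  -- the three families of terms
  set T : ℤ → ℕ → ℝ := fun m k' =>
    B ((Real.log ((n : ℝ) * ℓ' * k' / ℓ) - Real.log (((n : ℝ) * ℓ' * k' + g * m) / ℓ)) / h)
      / Real.sqrt (((n : ℝ) * ℓ' * k' + g * m) / ℓ) / Real.sqrt k' / Real.sqrt n with hT
  set W : ℤ → ℕ → ℝ := fun m k' => B (-((g : ℝ) * m) / ((n : ℝ) * ℓ' * h) / k') / k' * ρ / n with hW
  set I : Finset ℤ := Finset.Icc (-(M₀ : ℤ)) M₀ with hI
  set filt : ℤ → Finset ℕ := fun m => (Finset.Icc 1 K₁).filter (fun k' : ℕ => (P : ℤ) ∣ m + (Q : ℤ) * k') with hfilt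
  -- (1) reorganisation
  have hre := family_reorg (M := M) (M₀ := M₀) hBs hh hh8 hn hℓ hℓ' hK₁ hM₀
  have hre' : ∑ k' ∈ Finset.Icc 1 K₁, (∑ k ∈ Finset.Icc 1 M,
      B ((Real.log ((n : ℝ) * ℓ' * k' / ℓ) - Real.log k) / h) / Real.sqrt k) / Real.sqrt k' / Real.sqrt n
      = ∑ m ∈ I, ∑ k' ∈ filt m, T m k' := by
    rw [hre]
  -- (2) approximation by the family weights
  have happrox : |∑ m ∈ I, ∑ k' ∈ filt m, (T m k' - W m k')|
      ≤ (192 * N₁ + 12 * N₀) * h * ρ * (16 * h * ℓ' * K₁ / g + (∑ j ∈ Finset.Icc 1 K₁, (1 : ℝ) / j) / n) := by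
    have hswap : ∑ m ∈ I, ∑ k' ∈ filt m, (T m k' - W m k')
        = ∑ k' ∈ Finset.Icc 1 K₁, ∑ m ∈ I.filter (fun m => (P : ℤ) ∣ m + (Q : ℤ) * k'), (T m k' - W m k') :=
      sum_filter_comm I (Finset.Icc 1 K₁) (fun m k' => (P : ℤ) ∣ m + (Q : ℤ) * k') (fun m k' => T m k' - W m k')
    rw [hswap]
    refine (Finset.abs_sum_le_sum_abs _ _).trans ?_
    have hpt : ∀ k' ∈ Finset.Icc 1 K₁, |∑ m ∈ I.filter (fun m => (P : ℤ) ∣ m + (Q : ℤ) * k'), (T m k' - W m k')|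
        ≤ (192 * N₁ + 12 * N₀) * h * ρ * (16 * h * ℓ' / g + 1 / ((n : ℝ) * k')) := by
      intro k' hk'
      have hk'1 : 1 ≤ k' := (Finset.mem_Icc.1 hk').1
      have hk'0 : (0 : ℝ) < k' := by exact_mod_cast hk'1
      have hb := abs_sum_familyT_sub_familyW_le (ℓ := ℓ) hB h0 h1 hBs hh hh16 hn hℓ hℓ' hk'1 hgR
        (I.filter (fun m => (P : ℤ) ∣ m + (Q : ℤ) * k'))
      have hwt : 1 / (Real.sqrt ((n : ℝ) * ℓ' * k' / ℓ) * Real.sqrt k' * Real.sqrt n) = ρ / ((n : ℝ) * k') := by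
        rw [sqrt_node_mul hℓ, hρ]
        have hsℓ : 0 < Real.sqrt (ℓ : ℝ) := Real.sqrt_pos.2 hℓ0
        have hsℓ' : 0 < Real.sqrt (ℓ' : ℝ) := Real.sqrt_pos.2 hℓ'0
        field_simp
      have hT' : ∀ m, T m k' - W m k' =
          B ((Real.log ((n : ℝ) * ℓ' * k' / ℓ) - Real.log (((n : ℝ) * ℓ' * k' + g * m) / ℓ)) / h)
            / Real.sqrt (((n : ℝ) * ℓ' * k' + g * m) / ℓ) / Real.sqrt k' / Real.sqrt n
          - B (-((g : ℝ) * m) / ((n : ℝ) * ℓ' * h) / k') / k' * (Real.sqrt ℓ / Real.sqrt ℓ') / n := fun m => by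
        simp only [hT, hW, hρ]
      simp only [hT'] 
      refine hb.trans (le_of_eq ?_)
      rw [mul_div_assoc, ← one_div_mul_eq_div (Real.sqrt ((n : ℝ) * ℓ' * k' / ℓ) * Real.sqrt k' * Real.sqrt n)] 
      rw [hwt]
      field_simp
    refine (Finset.sum_le_sum hpt).trans (le_of_eq ?_)
    rw [← Finset.mul_sum, Finset.sum_add_distrib, Finset.sum_const, Nat.card_Icc, Nat.add_sub_cancel, nsmul_eq_mul,
      Finset.sum_div]
    have hs : ∑ k' ∈ Finset.Icc 1 K₁, 1 / ((n : ℝ) * k') = ∑ k' ∈ Finset.Icc 1 K₁, (1 : ℝ) / k' / n :=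
      Finset.sum_congr rfl fun k' _ => by rw [div_div, mul_comm]
    rw [hs]
    ring
  -- (3a) the family `m = 0`
  have h0I : (0 : ℤ) ∈ I := by simp [hI]
  have hzero : ∑ k' ∈ filt 0, W 0 k' = B 0 * ρ / n * (1 / (P : ℝ)) * ∑ j ∈ Finset.Icc 1 (K₁ / P), (1 : ℝ) / j := by
    simp only [hfilt, hW]
    rw [filter_family_zero hQP, Finset.sum_filter]
    have : ∀ k' ∈ Finset.Icc 1 K₁, (if P ∣ k' then B (-((g : ℝ) * ((0 : ℤ) : ℝ)) / ((n : ℝ) * ℓ' * h) / k') / k' * ρ / n else 0)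
        = B 0 * ρ / n * (if P ∣ k' then (1 : ℝ) / k' else 0) := by
      intro k' _
      split_ifs
      · simp; ring
      · simp
    rw [Finset.sum_congr rfl this, ← Finset.mul_sum, sum_ite_dvd_inv_eq hP1]
    ring
  -- (3b) the families `m ≠ 0`
  have hfam : ∀ m ∈ I.erase 0, |∑ k' ∈ filt m, W m k'
      - ρ / n * (1 / (P : ℝ)) * ∫ s in (0 : ℝ)..K₁, B (-(m : ℝ) * K₀ / s) / s|
      ≤ (16 * N₁ + 14 * N₀) * ρ * (ℓ' * h / g) * (1 / |(m : ℝ)|) := by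
    intro m hm
    have hm0 : (m : ℝ) ≠ 0 := by exact_mod_cast (Finset.mem_erase.1 hm).1
    have hmpos : 0 < |(m : ℝ)| := abs_pos.2 hm0
    have hc : -((g : ℝ) * m) / ((n : ℝ) * ℓ' * h) ≠ 0 := by
      refine div_ne_zero (neg_ne_zero.2 (mul_ne_zero hgR.ne' hm0)) (by positivity)
    have hb := abs_familySum_sub_integral_le hB hB' h0 h1 hBs hc hP1 hQP m K₁
    have habs : |-((g : ℝ) * m) / ((n : ℝ) * ℓ' * h)| = (g : ℝ) * |(m : ℝ)| / ((n : ℝ) * ℓ' * h) := by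
      rw [abs_div, abs_neg, abs_mul, abs_of_pos hgR, abs_of_pos (by positivity : (0 : ℝ) < (n : ℝ) * ℓ' * h)]
    rw [habs] at hb
    -- the family sum and the integral in the local names
    have hsumW : ∑ k' ∈ filt m, W m k'
        = ρ / n * ∑ k' ∈ (Finset.Icc 1 K₁).filter (fun k' : ℕ => (P : ℤ) ∣ m + (Q : ℤ) * k'),
            B (-((g : ℝ) * m) / ((n : ℝ) * ℓ' * h) / k') / k' := by
      simp only [hfilt, hW, Finset.mul_sum]
      refine Finset.sum_congr rfl fun k' _ => by ring
    have hint : ∫ s in (0 : ℝ)..K₁, B (-(m : ℝ) * K₀ / s) / s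
        = ∫ s in (0 : ℝ)..K₁, B (-((g : ℝ) * m) / ((n : ℝ) * ℓ' * h) / s) / s := by
      refine intervalIntegral.integral_congr fun s _ => ?_
      simp only [hK₀]
      congr 2
      field_simp
    have hdiff : ∑ k' ∈ filt m, W m k' - ρ / n * (1 / (P : ℝ)) * ∫ s in (0 : ℝ)..K₁, B (-(m : ℝ) * K₀ / s) / s
        = ρ / n * ((∑ k' ∈ (Finset.Icc 1 K₁).filter (fun k' : ℕ => (P : ℤ) ∣ m + (Q : ℤ) * k'),
            B (-((g : ℝ) * m) / ((n : ℝ) * ℓ' * h) / k') / k')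
            - 1 / (P : ℝ) * ∫ s in (0 : ℝ)..K₁, B (-((g : ℝ) * m) / ((n : ℝ) * ℓ' * h) / s) / s) := by
      rw [hsumW, hint]; ring
    rw [hdiff, abs_mul, abs_of_nonneg (by positivity : 0 ≤ ρ / n)]
    calc ρ / n * |(∑ k' ∈ (Finset.Icc 1 K₁).filter (fun k' : ℕ => (P : ℤ) ∣ m + (Q : ℤ) * k'),
            B (-((g : ℝ) * m) / ((n : ℝ) * ℓ' * h) / k') / k')
            - 1 / (P : ℝ) * ∫ s in (0 : ℝ)..K₁, B (-((g : ℝ) * m) / ((n : ℝ) * ℓ' * h) / s) / s|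
        ≤ ρ / n * ((16 * N₁ + 14 * N₀) / ((g : ℝ) * |(m : ℝ)| / ((n : ℝ) * ℓ' * h))) :=
          mul_le_mul_of_nonneg_left hb (by positivity)
      _ = (16 * N₁ + 14 * N₀) * ρ * (ℓ' * h / g) * (1 / |(m : ℝ)|) := by
          field_simp
  -- (3c) summing the families `m ≠ 0`
  set J : ℝ := ∑ m ∈ I.erase 0, ∫ s in (0 : ℝ)..K₁, B (-(m : ℝ) * K₀ / s) / s with hJ
  have hfamsum : |(∑ m ∈ I.erase 0, ∑ k' ∈ filt m, W m k') - ρ / n * (1 / (P : ℝ)) * J|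
      ≤ (16 * N₁ + 14 * N₀) * ρ * (ℓ' * h / g) * (2 * (1 + Real.log (M₀ + 1))) := by
    rw [hJ, Finset.mul_sum, ← Finset.sum_sub_distrib]
    refine (Finset.abs_sum_le_sum_abs _ _).trans ((Finset.sum_le_sum hfam).trans ?_)
    rw [← Finset.mul_sum]
    exact mul_le_mul_of_nonneg_left (sum_inv_abs_le M₀) (by positivity)
  -- (4) the periodization integral
  have hVK' : 1 / 2 ≤ (K₁ : ℝ) / K₀ := by rw [hVK]; exact hV
  have hVM' : 2 * ((K₁ : ℝ) / K₀) < M₀ + 1 := by rw [hVK]; exact hVM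
  have hper := sum_family_integrals_eq (M₀ := M₀) hB hB' h2 hBs hK₀0 hVK' hVM'
  rw [hVK] at hper
  -- (5) assemble
  have hsplitW : ∑ m ∈ I, ∑ k' ∈ filt m, W m k' = (∑ k' ∈ filt 0, W 0 k') + ∑ m ∈ I.erase 0, ∑ k' ∈ filt m, W m k' :=
    (Finset.add_sum_erase I (fun m => ∑ k' ∈ filt m, W m k') h0I).symm
  have hTW : ∑ m ∈ I, ∑ k' ∈ filt m, T m k'
      = (∑ m ∈ I, ∑ k' ∈ filt m, W m k') + ∑ m ∈ I, ∑ k' ∈ filt m, (T m k' - W m k') := by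
    rw [← Finset.sum_add_distrib]
    refine Finset.sum_congr rfl fun m _ => ?_
    rw [← Finset.sum_add_distrib]
    refine Finset.sum_congr rfl fun k' _ => by ring
  have key : (∑ k' ∈ Finset.Icc 1 K₁, (∑ k ∈ Finset.Icc 1 M,
        B ((Real.log ((n : ℝ) * ℓ' * k' / ℓ) - Real.log k) / h) / Real.sqrt k) / Real.sqrt k' / Real.sqrt n)
      - B 0 * ρ / n * (1 / (P : ℝ)) * (∑ j ∈ Finset.Icc 1 (K₁ / P), (1 : ℝ) / j)
      - ρ / n * (1 / (P : ℝ)) *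
          ((∫ v in Ioi (1 / 2 : ℝ), ((∑' m : ℤ, B (m / v)) - v * ∫ x, B x) / v)
            - (∫ v in Ioi V, ((∑' m : ℤ, B (m / v)) - v * ∫ x, B x) / v)
            + (∫ x, B x) * (V - 1 / 2) - B 0 * Real.log (2 * V))
      = ((∑ m ∈ I.erase 0, ∑ k' ∈ filt m, W m k') - ρ / n * (1 / (P : ℝ)) * J)
        + ∑ m ∈ I, ∑ k' ∈ filt m, (T m k' - W m k') := by
    rw [hre', hTW, hsplitW, ← hzero, ← hper]
    ring
  rw [key]
  calc |((∑ m ∈ I.erase 0, ∑ k' ∈ filt m, W m k') - ρ / n * (1 / (P : ℝ)) * J)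
        + ∑ m ∈ I, ∑ k' ∈ filt m, (T m k' - W m k')|
      ≤ |(∑ m ∈ I.erase 0, ∑ k' ∈ filt m, W m k') - ρ / n * (1 / (P : ℝ)) * J|
        + |∑ m ∈ I, ∑ k' ∈ filt m, (T m k' - W m k')| := abs_add_le _ _
    _ ≤ (16 * N₁ + 14 * N₀) * ρ * (ℓ' * h / g) * (2 * (1 + Real.log (M₀ + 1)))
        + (192 * N₁ + 12 * N₀) * h * ρ * (16 * h * ℓ' * K₁ / g + (∑ j ∈ Finset.Icc 1 K₁, (1 : ℝ) / j) / n) :=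
          add_le_add hfamsum happrox
    _ = _ := by ring

/-- **Anchor `combTypeFamilyBlock`** (registered sub-goal; `family_block_eval` with explicit quantifiers): the full-teeth block of a
node weight through its families. [folklore] -/
theorem combTypeFamilyBlock : ∀ B B' B'' : ℝ → ℝ, ∀ N₀ N₁ N₂ h : ℝ, ∀ n ℓ ℓ' K₁ M M₀ : ℕ, (∀ x, HasDerivAt B (B' x) x) → (∀ x, HasDerivAt B' (B'' x) x) → (∀ x, |B x| ≤ N₀) → (∀ x, |B' x| ≤ N₁) → (∀ x, |B'' x| ≤ N₂) → (∀ x, 2 < |x| → B x = 0) → (0 < h) → (h ≤ 1 / 16) → (1 ≤ n) → (1 ≤ ℓ) → (1 ≤ ℓ') → ((n : ℝ) * ℓ' * K₁ * Real.exp (2 * h) ≤ ℓ * M) → (8 * h * n * ℓ' * K₁ ≤ Nat.gcd (n * ℓ') ℓ * M₀) → (1 / 2 ≤ (K₁ : ℝ) * n * ℓ' * h / Nat.gcd (n * ℓ') ℓ) → (2 * ((K₁ : ℝ) * n * ℓ' * h / Nat.gcd (n * ℓ') ℓ) < M₀ + 1) → |∑ k' ∈ Finset.Icc 1 K₁, (∑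 k ∈ Finset.Icc 1 M, B ((Real.log ((n : ℝ) * ℓ' * k' / ℓ) - Real.log k) / h) / Real.sqrt k) / Real.sqrt k' / Real.sqrt n - B 0 * (Real.sqrt ℓ / Real.sqrt ℓ') / n * (1 / ((ℓ / Nat.gcd (n * ℓ') ℓ : ℕ) : ℝ)) * ∑ j ∈ Finset.Icc 1 (K₁ / (ℓ / Nat.gcd (n * ℓ') ℓ)), (1 : ℝ) / j - (Real.sqrt ℓ / Real.sqrt ℓ') / n * (1 / ((ℓ / Nat.gcd (n * ℓ') ℓ : ℕ) : ℝ)) * ((∫ v in Set.Ioi (1 / 2 : ℝ), ((∑' m : ℤ, B (m / v)) - v * ∫ x, B x) / v) - (∫ v in Set.Ioi ((K₁ : ℝ) * n * ℓ' * h / Nat.gcd (n * ℓ') ℓ), ((∑' m : ℤ, B (m / v)) - v * ∫ x, B x) / v) + (∫ x, B x) * ((K₁ : ℝ) * n * ℓ' * h / Nat.gcd (n * ℓ') ℓ - 1 / 2) - B 0 * Real.log (2 * ((K₁ : ℝ) * n * ℓ' * h / Nat.gcd (n * ℓ') ℓ)))| ≤ (192 * N₁ + 12 * N₀) * h * (Real.sqrt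 ℓ / Real.sqrt ℓ') * (16 * h * ℓ' * K₁ / Nat.gcd (n * ℓ') ℓ + (∑ j ∈ Finset.Icc 1 K₁, (1 : ℝ) / j) / n) + (16 * N₁ + 14 * N₀) * (Real.sqrt ℓ / Real.sqrt ℓ') * (ℓ' * h / Nat.gcd (n * ℓ') ℓ) * (2 * (1 + Real.log (M₀ + 1))) :=
  fun _ _ _ _ _ _ _ _ _ _ _ _ _ hB hB' h0 h1 h2 hBs hh hh16 hn hℓ hℓ' hK₁ hM₀ hV hVM =>
    family_block_eval hB hB' h0 h1 h2 hBs hh hh16 hn hℓ hℓ' hK₁ hM₀ hV hVM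

end CombType

end Summit.RiemannHypothesis.RiemannHypothesis.Theorems.SignConeConeMagnification

end
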